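import Summits.ResolutionOfSingularities.ResolutionOfSingularities.Theorems.EquisingularLiftEquisingularLiftNatChartLiftPatching
import Summits.ResolutionOfSingularities.ResolutionOfSingularities.Theorems.EquisingularLiftEquisingularLiftNatEmbeddedLiftChartLocal
import Summits.ResolutionOfSingularities.ResolutionOfSingularities.Theorems.EquisingularLiftEquisingularLiftNatUniformizerPowLevels
import Summits.ResolutionOfSingularities.ResolutionOfSingularities.Theorems.EquisingularLiftEquisingularLiftNatEmbeddedInfinitesimalLiftFactDefs
import Mathlib.Topology.Sheaves.SheafCondition.Sites
import HarnessLib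

/-!
# [OURS · L1 W4.5(b) · EL♮(3) · J1c (π) brick F7] `EmbeddedInfinitesimalLiftFact` is a theorem

Crux chain w45b (cell `res-hironaka`, slot W4.5(b)), child crux **EL♮(3)** = stmt-ResolutionOfSingularities-20148; J1 = `EmbeddedInfinitesimalLiftFact`
(p596985, the NEED-FACT of record of the registered stub `stub_elnat_embeddedInfinitesimalLiftFact`): R. Hartshorne, *Deformation Theory* (2010), Thm. 6.2 (b)
with Rem. 6.2.1 / Thm. 9.2 (b), instance `O/𝔪ⁿ⁺² ↠ O/𝔪ⁿ⁺¹`. This file DISCHARGES it: `embeddedInfinitesimalLiftFact_holds : EmbeddedInfinitesimalLiftFact`, assembling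
* the local existence of chart lifts at the points of `Y₀` — res-L1-w45b-stub-4's B4 `exists_affine_chartLift` (p610186; Hartshorne Thm. 9.2 (b): the Koszul
  complex of lifted regular generators), with the fibre embedding `fibreEmb (n+1)` (F5a p609778) as the chart map of the special fibre;
* the trivial chart lifts (unit ideal) off the image of `Y₀`;
* the patching engine (π) `exists_idealSheafData_comap_eq_ker_and_flat` (F6b; Hartshorne Thm. 6.2 (b): the differences of local lifts form a Čech
  1-cocycle of the normal sheaf, a coboundary by `Ȟ¹ = 0`, so corrected lifts glue), with the base data `ε = ϖⁿ⁺¹`, `ann ε = 𝔪` (Levels p602708);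
* (γ♯) `exists_closedImmersion_flat_isPullback_of_idealSheafData` (p602990): the glued ideal sheaf is a flat closed subscheme restricting to `Yₙ`.
OURS; NOT a statement of H. Hironaka's 2017 manuscript; AI-written, gate-checked, weaker than expert review — the kernel checks THIS rendering of a
published theorem, which is consumed by the crux skeleton only as the hypothesis it always was. No `sorry`; standard axioms; DEF-FREE.
`--supports stmt-ResolutionOfSingularities-20148 --as helper`.

References (method / index only): R. Hartshorne, *Deformation Theory* (2010), Thm. 6.2, Rem. 6.2.1, Thm. 9.2, pp. 47–49, 80.
-/

set_option linter.dupNamespace false -- mandated namespace `Summit.<Summit>.<Problem>` of this single-conjunct summit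
-- `TopCat.Presheaf`/`Scheme.Modules` are not reducible (as in Mathlib's `AlgebraicGeometry/Modules` and the tree's `Modules/*`).
set_option backward.isDefEq.respectTransparency false

noncomputable section

open CategoryTheory CategoryTheory.Limits AlgebraicGeometry Opposite TopologicalSpace IsLocalRing
open Literature.AlgebraicGeometry.Morphisms Literature.AlgebraicGeometry.Modules Literature.AlgebraicGeometry.Deformation
open Literature.AlgebraicGeometry.HodgeTheory

namespace Summit.ResolutionOfSingularities.ResolutionOfSingularities.Cruxes.EquisingularLiftNat.Sections

/-! ## Small tools -/

/-- Sections of a scheme over an open with no points form the zero ring. [folklore] -/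
theorem subsingleton_sections_of_eq_bot {X : Scheme.{0}} {U : X.Opens} (hU : U = ⊥) : Subsingleton Γ(X, U) :=
  CommRingCat.subsingleton_of_isTerminal ((TopCat.Sheaf.isTerminalOfEqEmpty X.sheaf hU))

/-- A ring map into the zero ring has kernel `⊤`. [folklore] -/
theorem ker_eq_top_of_subsingleton {R S : Type*} [CommRing R] [CommRing S] [Subsingleton S] (φ : R →+* S) : RingHom.ker φ = ⊤ :=
  eq_top_iff.mpr fun _ _ => (RingHom.mem_ker).mpr (Subsingleton.elim _ _)

/-- `Fin`-indexed form of a list of weakly regular generators. [folklore] -/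
theorem exists_fin_of_list {R : Type} [CommRing R] {I : Ideal R} (h : ∃ rs : List R, RingTheory.Sequence.IsWeaklyRegular R rs ∧ Ideal.ofList rs = I) :
    ∃ (m : ℕ) (x : Fin m → R), RingTheory.Sequence.IsWeaklyRegular R (List.ofFn x) ∧ Ideal.span (Set.range x) = I := by
  obtain ⟨rs, hreg, hI⟩ := h
  refine ⟨rs.length, rs.get, by rwa [List.ofFn_get], ?_⟩
  rw [Set.range_list_get]
  exact hI

/-- `[1]` is a weakly regular sequence generating the unit ideal. [folklore] -/
theorem exists_fin_of_eq_top {R : Type} [CommRing R] {I : Ideal R} (h : I = ⊤) :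
    ∃ (m : ℕ) (x : Fin m → R), RingTheory.Sequence.IsWeaklyRegular R (List.ofFn x) ∧ Ideal.span (Set.range x) = I := by
  refine exists_fin_of_list ⟨[1], ?_, by rw [Ideal.ofList_singleton, Ideal.span_singleton_one, h]⟩
  exact (RingTheory.Sequence.isWeaklyRegular_singleton_iff _ _).mpr fun a b hab => by simpa using hab

/-! ## The discharge -/

/-- **`EmbeddedInfinitesimalLiftFact` holds** (Hartshorne 2010, Thm. 6.2 (b) with Rem. 6.2.1 / Thm. 9.2 (b), for the small extension `O/𝔪ⁿ⁺² ↠ O/𝔪ⁿ⁺¹`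
of a DVR): the chart lifts of stub-4's B4 and the trivial lifts off `Y₀` patch, by the engine (π), to a flat closed subscheme of `Wₙ₊₁` restricting to `Yₙ`.
[cite: Hartshorne2010, Thm. 6.2 (b), Rem. 6.2.1, Thm. 9.2 (b)] -/
theorem embeddedInfinitesimalLiftFact_holds : EmbeddedInfinitesimalLiftFact := by
  intro O _ _ _ k _ θ hθ W w W₀ jW tW hsq hflat hlft Y₀ ι hι hlci hCech n Yn jn hjn hflatn hs₀
  classical
  haveI := hι
  haveI := hjn
  haveI := hflatn
  obtain ⟨s₀, hs₀⟩ := hs₀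
  obtain ⟨V, hVaff, -, hVcov, hH1⟩ := hCech
  -- the base: `𝔪 = ker θ`, a uniformizer, `ε = ϖⁿ⁺¹`
  have hker : RingHom.ker θ = maximalIdeal O := ker_eq_maximalIdeal_of_surjective θ hθ
  have hI : maximalIdeal O ≤ RingHom.ker θ := hker.ge
  have hI' : RingHom.ker θ ≤ maximalIdeal O := hker.le
  obtain ⟨ϖ, hϖ⟩ := IsDiscreteValuationRing.exists_irreducible O
  have hkert : RingHom.ker (infinitesimalNeighbourhood.transitionRingHom (maximalIdeal O) n) =
      Ideal.span {Ideal.Quotient.mk (maximalIdeal O ^ (n + 1 + 1)) (ϖ ^ (n + 1))} :=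
    (Levels.ker_factor_eq_map_pow (O := O) (n + 1)).trans (Levels.map_pow_eq_span_mk_pow hϖ (n + 1))
  have hann : ∀ c : O ⧸ maximalIdeal O ^ (n + 1 + 1), Ideal.Quotient.mk (maximalIdeal O ^ (n + 1 + 1)) (ϖ ^ (n + 1)) * c = 0 ↔
      c ∈ (RingHom.ker θ).map (Ideal.Quotient.mk (maximalIdeal O ^ (n + 1 + 1))) := fun c => by
    rw [hker]; exact Levels.mk_pow_mul_eq_zero_iff hϖ (n + 1) c
  have hεm : Ideal.Quotient.mk (maximalIdeal O ^ (n + 1 + 1)) (ϖ ^ (n + 1)) ∈ (RingHom.ker θ).map (Ideal.Quotient.mk (maximalIdeal O ^ (n + 1 + 1))) := by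
    rw [hker]; exact Levels.mk_pow_succ_mem_map hϖ (n + 1) n
  have hnil : IsNilpotent ((RingHom.ker θ).map (Ideal.Quotient.mk (maximalIdeal O ^ (n + 1 + 1)))) := by
    rw [hker]; exact Levels.isNilpotent_map_maximalIdeal (n + 1)
  -- `W₀` is locally Noetherian (locally of finite type over the field `k`)
  haveI : LocallyOfFiniteType tW := MorphismProperty.of_isPullback hsq hlft
  haveI : IsLocallyNoetherian W₀ := LocallyOfFiniteType.isLocallyNoetherian tW
  -- the fibre embeddings
  haveI hfE : IsClosedImmersion (fibreEmb (maximalIdeal O) w θ hI hsq n) := isClosedImmersion_fibreEmb _ w θ hI hsq hθ n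
  haveI hfE' : IsClosedImmersion (fibreEmb (maximalIdeal O) w θ hI hsq (n + 1)) := isClosedImmersion_fibreEmb _ w θ hI hsq hθ (n + 1)
  haveI ht : IsClosedImmersion (infinitesimalNeighbourhood.transition (maximalIdeal O) w n) := isClosedImmersion_transition _ w n
  haveI : Surjective (fibreEmb (maximalIdeal O) w θ hI hsq (n + 1)) := surjective_fibreEmb _ w θ hI hsq hθ hI' (n + 1)
  haveI : Surjective (fibreEmb (maximalIdeal O) w θ hI hsq n) := surjective_fibreEmb _ w θ hI hsq hθ hI' n
  -- `e := fibreEmb (n+1)` versus `fibreEmb n ≫ t` on opens and points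
  have hpre : ∀ U : (infinitesimalNeighbourhood (maximalIdeal O) w (n + 1)).Opens,
      fibreEmb (maximalIdeal O) w θ hI hsq n ⁻¹ᵁ ((infinitesimalNeighbourhood.transition (maximalIdeal O) w n) ⁻¹ᵁ U) =
        fibreEmb (maximalIdeal O) w θ hI hsq (n + 1) ⁻¹ᵁ U := fun U => by
    rw [← Scheme.Hom.comp_preimage, fibreEmb_transition]
  have hpt : ∀ x₀ : W₀, (infinitesimalNeighbourhood.transition (maximalIdeal O) w n).base ((fibreEmb (maximalIdeal O) w θ hI hsq n).base x₀) =
      (fibreEmb (maximalIdeal O) w θ hI hsq (n + 1)).base x₀ := fun x₀ => by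
    rw [← Scheme.Hom.comp_apply, fibreEmb_transition]
  -- `s₀` is surjective (base change of the surjective `fibreEmb n`)
  have hsq₀ := isPullback_fibreEmb_of_isPullback_ι (maximalIdeal O) w θ hI hsq n hs₀
  haveI : Surjective s₀ := MorphismProperty.of_isPullback hsq₀.flip inferInstance
  -- charts at every point
  have hcharts : ∀ x : infinitesimalNeighbourhood (maximalIdeal O) w (n + 1),
      ∃ U : (infinitesimalNeighbourhood (maximalIdeal O) w (n + 1)).affineOpens,
        x ∈ (U : (infinitesimalNeighbourhood (maximalIdeal O) w (n + 1)).Opens) ∧ HasLciTrace (maximalIdeal O) w n θ hθ hI hsq ι U ∧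
          ∃ J, IsChartLift (maximalIdeal O) w n jn U J := by
    intro x
    obtain ⟨x₀, rfl⟩ := (fibreEmb (maximalIdeal O) w θ hI hsq (n + 1)).surjective x
    by_cases hx₀ : x₀ ∈ Set.range ι.base
    · -- over a point of `Y₀`: stub-4's B4 chart inside the open `X' ∖ e(W₀ ∖ Uz)`
      obtain ⟨z, rfl⟩ := hx₀
      obtain ⟨Uz, hzU, hUz⟩ := hlci z
      obtain ⟨U, hxU, hUN, I', hflatI', hclause⟩ := exists_affine_chartLift hsq hθ (fibreRingHom_comp_mk (maximalIdeal O) θ hI (n + 1))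
        (fibreEmb_ι (maximalIdeal O) w θ hI hsq (n + 1)) (fibreEmb_toSpec (maximalIdeal O) w θ hI hsq (n + 1)) hs₀ hzU hUz
        (complOpens (fibreEmb (maximalIdeal O) w θ hI hsq (n + 1)) Uz) (base_mem_complOpens _ hzU)
      refine ⟨U, hxU, ?_, I', ?_, hclause⟩
      · -- lci on the trace chart: the trace lies in `Uz`
        have hle : (traceChart (maximalIdeal O) w n θ hθ hI hsq U : W₀.Opens) ≤ Uz := by
          rw [coe_traceChart, hpre, ← preimage_complOpens (fibreEmb (maximalIdeal O) w θ hI hsq (n + 1)) Uz]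
          exact (fibreEmb (maximalIdeal O) w θ hI hsq (n + 1)).preimage_mono hUN
        exact exists_fin_of_list (exists_isWeaklyRegular_generators_of_le ι.ker (U := traceChart (maximalIdeal O) w n θ hθ hI hsq U) hle hUz)
      · -- flatness in the `chartAlg` currency
        letI := chartAlg (maximalIdeal O) w (n + 1) U
        have h : (algebraMap (O ⧸ maximalIdeal O ^ (n + 1 + 1)) (Γ(infinitesimalNeighbourhood (maximalIdeal O) w (n + 1), U) ⧸ I')).Flat := by
          rw [← Ideal.Quotient.mk_comp_algebraMap, algebraMap_chartAlg]; exact hflatI'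
        exact RingHom.flat_algebraMap_iff.mp h
    · -- off `Y₀`: a chart missing the image of `Y₀`, with the unit ideal
      set e := ι ≫ fibreEmb (maximalIdeal O) w θ hI hsq (n + 1) with he
      have hx : (fibreEmb (maximalIdeal O) w θ hI hsq (n + 1)).base x₀ ∉ Set.range e.base := by
        rintro ⟨y, hy⟩
        rw [he, Scheme.Hom.comp_apply] at hy
        exact hx₀ ⟨y, (fibreEmb (maximalIdeal O) w θ hI hsq (n + 1)).isClosedEmbedding.injective hy⟩
      have hxN := mem_complOpens_of_not_mem_range e ⊥ hx
      obtain ⟨U, hU, hxU, hUN⟩ := exists_isAffineOpen_mem_and_subset hxN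
      -- no point of `Y₀` maps into `U`
      have hempty : ∀ y : Y₀, e.base y ∉ U := fun y hy => by
        have h := hUN hy
        rw [SetLike.mem_coe, mem_complOpens_iff] at h
        exact h ⟨y, fun h' => h', rfl⟩
      have htrace : ι ⁻¹ᵁ (traceChart (maximalIdeal O) w n θ hθ hI hsq ⟨U, hU⟩ : W₀.Opens) = ⊥ := by
        refine le_bot_iff.mp fun y hy => hempty y ?_
        rw [he, Scheme.Hom.comp_apply, ← hpt]
        exact hy
      have hYn : jn ⁻¹ᵁ ((infinitesimalNeighbourhood.transition (maximalIdeal O) w n) ⁻¹ᵁ U) = ⊥ := by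
        refine le_bot_iff.mp fun y hy => ?_
        obtain ⟨y₀, rfl⟩ := s₀.surjective y
        refine hempty y₀ ?_
        rw [he, Scheme.Hom.comp_apply, ← hpt]
        have e1 : jn.base (s₀.base y₀) = (fibreEmb (maximalIdeal O) w θ hI hsq n).base (ι.base y₀) := by
          rw [← Scheme.Hom.comp_apply, ← Scheme.Hom.comp_apply, hsq₀.w]
        rw [← e1]
        exact hy
      refine ⟨⟨U, hU⟩, hxU, ?_, ⊤, ?_, ?_⟩
      · haveI := subsingleton_sections_of_eq_bot htrace
        refine exists_fin_of_eq_top ?_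
        rw [Scheme.Hom.ker_apply]
        exact ker_eq_top_of_subsingleton _
      · letI := chartAlg (maximalIdeal O) w (n + 1) ⟨U, hU⟩
        haveI : Subsingleton (Γ(infinitesimalNeighbourhood (maximalIdeal O) w (n + 1), U) ⧸ (⊤ : Ideal _)) :=
          Ideal.Quotient.subsingleton_iff.mpr rfl
        exact Module.Flat.of_free
      · haveI := subsingleton_sections_of_eq_bot hYn
        rw [Ideal.map_top]
        exact (ker_eq_top_of_subsingleton _).symm
  -- the patching engine (π)
  haveI : Nonempty (Fin 2) := ⟨0⟩
  haveI : IsLocallyNoetherian W₀ := inferInstance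
  obtain ⟨C, hcomap, hCflat⟩ := exists_idealSheafData_comap_eq_ker_and_flat (hq := hθ) (hI := hI) (hsq := hsq) hs₀ hkert hann hεm hnil
    V hVaff hVcov hH1 hcharts
  -- (γ♯)
  exact exists_closedImmersion_flat_isPullback_of_idealSheafData (infinitesimalNeighbourhood.transition (maximalIdeal O) w n)
    (infinitesimalNeighbourhood.toSpec (maximalIdeal O) w (n + 1)) jn C hcomap hCflat

/-- **The registered stub `stub_elnat_embeddedInfinitesimalLiftFact` of the crux skeleton `EquisingularLiftNatThree` (EL♮(3),
stmt-ResolutionOfSingularities-20148), BY NAME**: the NEED-FACT J1 is now a theorem of the tree. [cite: Hartshorne2010, Thm. 6.2 (b), Rem. 6.2.1, Thm. 9.2 (b)] -/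
theorem stub_elnat_embeddedInfinitesimalLiftFact : EmbeddedInfinitesimalLiftFact :=
  embeddedInfinitesimalLiftFact_holds

end Summit.ResolutionOfSingularities.ResolutionOfSingularities.Cruxes.EquisingularLiftNat.Sections

end
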